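import Mathlib
import HarnessLib
import Summits.Ventures.LatticeQCDFlow.Scaling.TiltedProtocolMoments
import Summits.Ventures.LatticeQCDFlow.Scaling.PathWorkMoments

/-!
# WorkExponentialMoments — every exponential moment of the Jarzynski work of the uniform switching
# protocol with ARBITRARY relaxation layers:
# `log E_F[e^{−t(W−ΔF)}] ≤ (½[t(t−1)]₊ + |t(t−1)|·θ_t/(1−θ_t))·σ̄²/n`, `θ_t = ρ·e^{(5|t|+2|t−1|)ΔD/(4n)}`,
# and the Chernoff tails of `W − ΔF` on both sides

HONEST FRAMING: exact (Metropolis-corrected) sampling algorithms for lattice gauge theory;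
figures of merit are autocorrelation/cost numbers at stated couplings and volumes; no
continuum-physics claim.

Venture `LatticeQCDFlow` (cell pub-lqcd), topic `Scaling`; FANOUT row 19 (`su2-snf`, GEN-6).
OUR WORK (elementary finite sums and one-variable calculus), nothing cited as a fact.  Setting:
finite configuration space, `S_c = S₀ + c•D`, uniform grid `c_k = k/n`, positive layers `P k` with
unit row sums leaving `e^{−S_{(k+1)/n}}` invariant and `χ²`-contracting towards `π_{(k+1)/n}` with
`ρ ≥ 0` (`Scaling/ChiSqContraction`; `ρ = λ⋆` for reversible irreducible layers); `|D x − D y| ≤ ΔD`,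
`Var_c(D) ≤ σ̄²` for all `c`; `ΔF = F(1) − F(0)`.  For a real `t` put
`θ_t = ρ·exp((5|t| + 2|t−1|)ΔD/(4n))` and assume `θ_t < 1`.

* **`tTiltMass_uniform_le`** — the `t`-tilted mass exceeds its perfect-relaxation value by at most
  the lag budget: `|ν_n^{(t)}| ≤ p_n^{(t)} · exp(|t(t−1)|·θ_t/(1−θ_t)·σ̄²/n)` (the 2×2 majorant system
  of `Scaling/TiltedProtocolRecursion` with `s = |t|e^{|t|ΔD/(2n)}σ̄/n`,
  `a = ρ|t−1|e^{|t−1|ΔD/(2n)}σ̄/n`; at `t = 1` the source `a` vanishes — Jarzynski has no lag);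
* the perfect part `Σ_{k<n} Λ_k(t) ≤ ½[t(t−1)]₊·σ̄²/n` is `Scaling/LinearFamilyStepMGF`'s
  `sum_stepLogMGF_uniform_le` (`½t(t−1)σ̄²/n²` per step for `t ∉ (0,1)`, `≤ 0` on `[0,1]`);
* **`expMoment_work_uniform_le` — THE MGF ENVELOPE**:
  `E_F[e^{−t(W − ΔF)}] ≤ exp((½[t(t−1)]₊ + |t(t−1)|·θ_t/(1−θ_t))·σ̄²/n)`; for `t ∉ (0,1)` the
  exponent is `½t(t−1)·((1+θ_t)/(1−θ_t))·σ̄²/n` — the Gaussian MGF with mean `½V`, variance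
  `V = 2τ̄σ̄²/n` (the AR(1) dictionary, `Scaling/AR1SwitchingJarzynski`, sharp to leading order);
  `t = 2` is the ESS floor of `Scaling/GeneralLayerESSFloor`, `t = 1` Jarzynski (envelope `= 1`);
* **CHERNOFF TAILS** (via the entry point `sum_ite_le_exp_mul_sum` of `Scaling/PathWorkMoments`,
  where the layer-independent `t = 1` tail `P_F(W ≤ ΔF − x) ≤ e^{−x}` also lives):
  `upperTail_work_le` — for `s > 0`,
  `P_F(W − ΔF ≥ x) ≤ exp(−s·x + (½s(s+1) + s(s+1)θ_{−s}/(1−θ_{−s}))·σ̄²/n)`;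
  `lowerTail_work_le` — for `t > 0`,
  `P_F(W − ΔF ≤ −x) ≤ exp(−t·x + (½[t(t−1)]₊ + |t(t−1)|θ_t/(1−θ_t))·σ̄²/n)` (at `t = 1`: the
  classical `P(W < ΔF − x) ≤ e^{−x}`; `t > 1` improves it for `x` beyond the variance scale);
* `expMoment_work_uniform_le_of_reversible` — the instance `ρ = max_k λ⋆(P_k)` (reversible layers).

Reading (value-free): the dissipated work with ANY reversible layers is sub-Gaussian around
`ΔF + ½V` with the AR(1) variance proxy `V = 2τ̄σ̄²/n`, for tilts `|t| ≲ n/ΔD` (beyond that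
`θ_t ≥ 1`, nothing claimed).  Layer families are indexed by every `k : ℕ` (extend a finite family
by any positive Boltzmann-invariant layer, e.g. perfect relaxation onto the next Gibbs law).
NOT CLAIMED: values of `ρ`, `σ̄`, `ΔD` for a lattice kernel; the
optimisation of the Chernoff parameter; non-uniform grids; sample (finite-run) versions.
-/

namespace Summit.Ventures.LatticeQCDFlow.Scaling

open Finset
open Literature.Probability.MarkovChains (IsRowStochastic IsStationary stepLaw DetailedBalance
  IsIrreducible lambdaStar lambdaStar_nonneg)
open Literature.Probability.ImportanceSampling (chiSqDiv chiSqDiv_def chiSqDiv_eq_sum_sq_div)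
open Summit.Ventures.LatticeQCDFlow.Exactness
open Summit.Ventures.LatticeQCDFlow.Theory2

variable {X : Type*} [Fintype X] [Nonempty X]
/-! ## The tilted mass along the uniform grid -/
/-- **`t`-TILTED MASS ALONG THE UNIFORM PROTOCOL.**  With `θ_t = ρ·e^{(5|t|+2|t−1|)ΔD/(4n)} < 1`:
`|ν_n^{(t)}| ≤ p_n^{(t)} · exp(|t(t−1)|·θ_t/(1−θ_t)·σ̄²/n)`. -/
theorem tTiltMass_uniform_le (t : ℝ) (S₀ D : X → ℝ) (P : ℕ → X → X → ℝ) {n : ℕ} (hn : n ≠ 0)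
    {ΔD ρ σbar : ℝ} (hD : ∀ x y, |D x - D y| ≤ ΔD) (hPpos : ∀ k x y, 0 < P k x y)
    (hProw : ∀ k x, ∑ y, P k x y = 1)
    (hK : ∀ k, ChiSqContracts (P k) (gibbsLaw (linAction S₀ D (((k + 1 : ℕ) : ℝ) / n))) ρ)
    (hρ : 0 ≤ ρ) (hσ0 : 0 ≤ σbar) (hσ : ∀ c, varD S₀ D c ≤ σbar ^ 2)
    (hθ1 : ρ * Real.exp ((5 * |t| + 2 * |t - 1|) * ΔD / (4 * n)) < 1) :
    ∑ x, tTiltLaw t S₀ D (fun k : ℕ => (k : ℝ) / n) P n x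
      ≤ tPerfMass t S₀ D (fun k : ℕ => (k : ℝ) / n) n
          * Real.exp (|t * (t - 1)| * ((ρ * Real.exp ((5 * |t| + 2 * |t - 1|) * ΔD / (4 * n)))
              / (1 - ρ * Real.exp ((5 * |t| + 2 * |t - 1|) * ΔD / (4 * n)))) * (σbar ^ 2 / n)) := by
  set c : ℕ → ℝ := fun k => (k : ℝ) / n with hc
  have hn' : (0 : ℝ) < n := Nat.cast_pos.mpr (Nat.pos_of_ne_zero hn)
  have hΔ : 0 ≤ ΔD := (abs_nonneg _).trans (hD (Classical.arbitrary X) (Classical.arbitrary X))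
  have hδ : ∀ k, c (k + 1) - c k = 1 / n := by intro k; rw [hc]; simp only; rw [uniform_step]
  have habs1 : ∀ k, |t * (c (k + 1) - c k)| = |t| / n := by
    intro k; rw [hδ k, abs_mul, abs_of_nonneg (by positivity : (0:ℝ) ≤ 1 / n)]; ring
  have habs2 : ∀ k, |t * (c (k + 1) - c k) - (c (k + 1) - c k)| = |t - 1| / n := by
    intro k
    rw [hδ k, show t * (1 / (n:ℝ)) - 1 / n = (t - 1) * (1 / n) by ring, abs_mul,
      abs_of_nonneg (by positivity : (0:ℝ) ≤ 1 / n)]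
    ring
  -- the two sequences and the constants of the majorant system
  set m : ℕ → ℝ := fun k => ∑ x, tTiltLaw t S₀ D c P k x with hm
  set E : ℕ → ℝ := fun k => massDev (gibbsLaw (linAction S₀ D (c k))) (tTiltLaw t S₀ D c P k)
    with hE
  set p : ℕ → ℝ := fun k => tPerfMass t S₀ D c k with hp
  set gb : ℕ → ℝ := fun k => ∑ x, gibbsLaw (linAction S₀ D (c k)) x * tWeight t D c k x with hgb
  have hp0 : ∀ k, 0 < p k := fun k => tPerfMass_pos t S₀ D c k
  have hgb0 : ∀ k, 0 < gb k := fun k => tEqFactor_pos t S₀ D c k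
  have hpsucc : ∀ k, p (k + 1) = p k * gb k := fun k => tPerfMass_succ t S₀ D c k
  have hE0 : ∀ k, 0 ≤ E k := fun k => massDev_nonneg _ _
  set M : ℝ := ΔD / n with hM
  have hM0 : 0 ≤ M := div_nonneg hΔ hn'.le
  set s : ℝ := |t| / n * Real.exp (|t| * M / 2) * σbar with hs
  set a : ℝ := ρ * (|t - 1| / n * Real.exp (|t - 1| * M / 2) * σbar) with ha
  set θ : ℝ := ρ * Real.exp ((5 * |t| + 2 * |t - 1|) * ΔD / (4 * n)) with hθ
  have hs0 : 0 ≤ s := by positivity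
  have ha0 : 0 ≤ a := by positivity
  have hθ0 : 0 ≤ θ := by positivity
  -- per-step inequalities
  have hu : ∀ k, m (k + 1) / p (k + 1) ≤ m k / p k + s * (E k / p k) := by
    intro k
    have step := sum_tTiltLaw_succ_le t S₀ D c P hD hProw hσ0 hσ k
    rw [habs1 k, show |t| / (n : ℝ) * ΔD / 2 = |t| * M / 2 by rw [hM]; ring] at step
    rw [hpsucc, div_le_iff₀ (mul_pos (hp0 k) (hgb0 k))]
    have hpk := (hp0 k).ne'
    have e : (m k / p k + s * (E k / p k)) * (p k * gb k)
        = gb k * (m k + |t| / n * Real.exp (|t| * M / 2) * σbar * E k) := by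
      rw [hs]; field_simp
    rw [e]
    exact step
  have hv : ∀ k, E (k + 1) / p (k + 1) ≤ a * (m k / p k) + θ * (E k / p k) := by
    intro k
    have step := massDev_tTiltLaw_succ_le t S₀ D c P hD hPpos hProw (fun k => hK k) hρ hσ0 hσ k
    rw [habs1 k, habs2 k,
      show (5 * (|t| / (n : ℝ) * ΔD) + 2 * (|t - 1| / n * ΔD)) / 4
        = (5 * |t| + 2 * |t - 1|) * ΔD / (4 * n) by field_simp,
      show |t - 1| / (n : ℝ) * ΔD / 2 = |t - 1| * M / 2 by rw [hM]; ring] at step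
    rw [hpsucc, div_le_iff₀ (mul_pos (hp0 k) (hgb0 k))]
    have hpk := (hp0 k).ne'
    have e : (a * (m k / p k) + θ * (E k / p k)) * (p k * gb k)
        = ρ * gb k * (Real.exp ((5 * |t| + 2 * |t - 1|) * ΔD / (4 * n)) * E k
            + |t - 1| / n * Real.exp (|t - 1| * M / 2) * σbar * m k) := by
      rw [ha, hθ]; field_simp; ring
    rw [e]
    exact step
  -- initial values
  have hu0 : m 0 / p 0 ≤ 1 := by
    rw [hm, hp]; simp only
    rw [tTiltLaw_zero, sum_gibbsLaw, tPerfMass, Finset.prod_range_zero, div_one]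
  have hv0 : E 0 / p 0 ≤ 0 := by
    rw [hE, hp]; simp only
    rw [tTiltLaw_zero, massDev_of_sum_eq_one _ (sum_gibbsLaw _), chiSqDiv_self_eq_zero,
      Real.sqrt_zero, zero_div]
  -- the majorant system
  have hθ1' : θ < 1 := hθ1
  have hbound := coupled_majorant_exp_bound (u := fun k => m k / p k) (v := fun k => E k / p k)
    hs0 ha0 hθ0 hθ1' hu0 hv0 hu hv n
  -- compare the rate with the lag budget
  have hrate : (n : ℝ) * (s * a / (1 - θ)) ≤ |t * (t - 1)| * (θ / (1 - θ)) * (σbar ^ 2 / n) := by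
    have h1θ : 0 < 1 - θ := by linarith
    have hexp : Real.exp (|t| * M / 2) * Real.exp (|t - 1| * M / 2)
        ≤ Real.exp ((5 * |t| + 2 * |t - 1|) * ΔD / (4 * n)) := by
      rw [← Real.exp_add]
      refine Real.exp_le_exp.mpr ?_
      rw [show (5 * |t| + 2 * |t - 1|) * ΔD / (4 * n) = (5 * |t| + 2 * |t - 1|) / 4 * M by
        rw [hM]; field_simp]
      nlinarith [abs_nonneg t, abs_nonneg (t - 1), hM0]
    have hsa : (n : ℝ) * (s * a) ≤ |t * (t - 1)| * θ * (σbar ^ 2 / n) := by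
      rw [hs, ha, hθ, abs_mul]
      have e1 : (n : ℝ) * (|t| / n * Real.exp (|t| * M / 2) * σbar
            * (ρ * (|t - 1| / n * Real.exp (|t - 1| * M / 2) * σbar)))
          = |t| * |t - 1| * (ρ * (Real.exp (|t| * M / 2) * Real.exp (|t - 1| * M / 2)))
              * (σbar ^ 2 / n) := by
        field_simp
      rw [e1]
      have := mul_le_mul_of_nonneg_left hexp hρ
      have hσn : 0 ≤ σbar ^ 2 / n := by positivity
      have htt : 0 ≤ |t| * |t - 1| := by positivity
      have := mul_le_mul_of_nonneg_left (mul_le_mul_of_nonneg_right this hσn) htt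
      nlinarith [this]
    rw [show (n : ℝ) * (s * a / (1 - θ)) = (n : ℝ) * (s * a) / (1 - θ) by ring,
      show |t * (t - 1)| * (θ / (1 - θ)) * (σbar ^ 2 / n)
        = |t * (t - 1)| * θ * (σbar ^ 2 / n) / (1 - θ) by ring]
    exact div_le_div_of_nonneg_right hsa h1θ.le
  have hfin : m n / p n ≤ Real.exp (|t * (t - 1)| * (θ / (1 - θ)) * (σbar ^ 2 / n)) :=
    hbound.trans (Real.exp_le_exp.mpr hrate)
  calc m n ≤ Real.exp (|t * (t - 1)| * (θ / (1 - θ)) * (σbar ^ 2 / n)) * p n :=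
        (div_le_iff₀ (hp0 n)).mp hfin
    _ = p n * Real.exp (|t * (t - 1)| * (θ / (1 - θ)) * (σbar ^ 2 / n)) := mul_comm _ _

/-- **THE MGF ENVELOPE OF THE DISSIPATED WORK (uniform grid, arbitrary layers).**
`E_F[e^{−t(W − ΔF)}] ≤ exp((½[t(t−1)]₊ + |t(t−1)|·θ_t/(1−θ_t))·σ̄²/n)`,
`θ_t = ρ·e^{(5|t|+2|t−1|)ΔD/(4n)} < 1`, `ΔF = F(1) − F(0)`. -/
theorem expMoment_work_uniform_le (t : ℝ) (S₀ D : X → ℝ) (P : ℕ → X → X → ℝ) {n : ℕ}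
    (hn : n ≠ 0) {ΔD ρ σbar : ℝ} (hD : ∀ x y, |D x - D y| ≤ ΔD) (hPpos : ∀ k x y, 0 < P k x y)
    (hProw : ∀ k x, ∑ y, P k x y = 1)
    (hK : ∀ k, ChiSqContracts (P k) (gibbsLaw (linAction S₀ D (((k + 1 : ℕ) : ℝ) / n))) ρ)
    (hρ : 0 ≤ ρ) (hσ0 : 0 ≤ σbar) (hσ : ∀ c, varD S₀ D c ≤ σbar ^ 2)
    (hθ1 : ρ * Real.exp ((5 * |t| + 2 * |t - 1|) * ΔD / (4 * n)) < 1) :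
    ∑ ω : Fin (n + 1) → X,
        pathLaw (gibbsLaw (linAction S₀ D (((0 : ℕ) : ℝ) / n))) (fun k : Fin n => P k) ω
          * Real.exp (-(t * (work (fun k : Fin (n + 1) => linAction S₀ D ((k : ℝ) / n)) ω
              - (linFreeEnergy S₀ D 1 - linFreeEnergy S₀ D 0))))
      ≤ Real.exp ((max (t * (t - 1)) 0 / 2
          + |t * (t - 1)| * ((ρ * Real.exp ((5 * |t| + 2 * |t - 1|) * ΔD / (4 * n)))
              / (1 - ρ * Real.exp ((5 * |t| + 2 * |t - 1|) * ΔD / (4 * n)))))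
          * (σbar ^ 2 / n)) := by
  set c : ℕ → ℝ := fun k => (k : ℝ) / n with hc
  have hn' : (0 : ℝ) < n := Nat.cast_pos.mpr (Nat.pos_of_ne_zero hn)
  set θ : ℝ := ρ * Real.exp ((5 * |t| + 2 * |t - 1|) * ΔD / (4 * n)) with hθ
  set ΔF := linFreeEnergy S₀ D 1 - linFreeEnergy S₀ D 0 with hΔF
  -- E[e^{-t(W-ΔF)}] = e^{tΔF} · |ν_n|
  have hsplit : ∀ ω : Fin (n + 1) → X,
      pathLaw (gibbsLaw (linAction S₀ D (((0 : ℕ) : ℝ) / n))) (fun k : Fin n => P k) ω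
          * Real.exp (-(t * (work (fun k : Fin (n + 1) => linAction S₀ D ((k : ℝ) / n)) ω - ΔF)))
        = Real.exp (t * ΔF)
          * (pathLaw (gibbsLaw (linAction S₀ D (c 0))) (fun k : Fin n => P k) ω
            * Real.exp (-(t * work (fun k : Fin (n + 1) => linAction S₀ D (c k)) ω))) := by
    intro ω
    rw [show -(t * (work (fun k : Fin (n + 1) => linAction S₀ D ((k : ℝ) / n)) ω - ΔF))
        = t * ΔF + -(t * work (fun k : Fin (n + 1) => linAction S₀ D (c k)) ω) by
          rw [hc]; ring, Real.exp_add]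
    rw [hc]; ring
  simp_rw [hsplit]
  rw [← mul_sum, sum_pathLaw_exp_neg_mul_work_eq t S₀ D c P n]
  -- the tilted mass and the perfect part
  have hmass := tTiltMass_uniform_le t S₀ D P hn hD hPpos hProw hK hρ hσ0 hσ hθ1
  have hperf := log_tPerfMass_add_eq_sum_stepLogMGF t S₀ D c n
  have hsum := sum_stepLogMGF_uniform_le t S₀ D hn (σbar := σbar) hσ
  have hcn : c n = 1 := by rw [hc]; simp only; rw [div_self hn'.ne']
  have hc0 : c 0 = 0 := by rw [hc]; simp
  simp only [hc] at hmass hperf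
  rw [show ((n : ℕ) : ℝ) / (n : ℝ) = 1 from div_self hn'.ne',
    show ((0 : ℕ) : ℝ) / (n : ℝ) = 0 by simp] at hperf
  have hp0 := tPerfMass_pos t S₀ D c n
  simp only [hc] at hp0
  -- p_n · e^{tΔF} = exp(Σ Λ_k)
  have hpexp : tPerfMass t S₀ D (fun k : ℕ => (k : ℝ) / n) n * Real.exp (t * ΔF)
      = Real.exp (∑ k ∈ Finset.range n,
          stepLogMGF S₀ D ((k : ℝ) / n) (((k + 1 : ℕ) : ℝ) / n - (k : ℝ) / n) t) := by
    rw [← hperf, Real.exp_add, Real.exp_log hp0, hΔF]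
  calc Real.exp (t * ΔF) * ∑ x, tTiltLaw t S₀ D (fun k : ℕ => (k : ℝ) / n) P n x
      ≤ Real.exp (t * ΔF) * (tPerfMass t S₀ D (fun k : ℕ => (k : ℝ) / n) n
          * Real.exp (|t * (t - 1)| * (θ / (1 - θ)) * (σbar ^ 2 / n))) :=
        mul_le_mul_of_nonneg_left hmass (Real.exp_pos _).le
    _ = Real.exp (∑ k ∈ Finset.range n,
          stepLogMGF S₀ D ((k : ℝ) / n) (((k + 1 : ℕ) : ℝ) / n - (k : ℝ) / n) t)
          * Real.exp (|t * (t - 1)| * (θ / (1 - θ)) * (σbar ^ 2 / n)) := by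
        rw [← hpexp]; ring
    _ ≤ Real.exp (max (t * (t - 1)) 0 / 2 * (σbar ^ 2 / n))
          * Real.exp (|t * (t - 1)| * (θ / (1 - θ)) * (σbar ^ 2 / n)) :=
        mul_le_mul_of_nonneg_right (Real.exp_le_exp.mpr hsum) (Real.exp_pos _).le
    _ = _ := by rw [← Real.exp_add]; congr 1; ring

/-! ## Chernoff tails of the dissipated work -/
/-- **UPPER TAIL OF THE WORK.**  For `s > 0` with `θ_{−s} = ρ·e^{(5s+2(s+1))ΔD/(4n)} < 1`:
`P_F(W − ΔF ≥ x) ≤ exp(−s·x + (½s(s+1) + s(s+1)·θ_{−s}/(1−θ_{−s}))·σ̄²/n)`. -/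
theorem upperTail_work_le (S₀ D : X → ℝ) (P : ℕ → X → X → ℝ) {n : ℕ} (hn : n ≠ 0)
    {ΔD ρ σbar s x : ℝ} (hD : ∀ x y, |D x - D y| ≤ ΔD) (hPpos : ∀ k x y, 0 < P k x y)
    (hProw : ∀ k x, ∑ y, P k x y = 1)
    (hK : ∀ k, ChiSqContracts (P k) (gibbsLaw (linAction S₀ D (((k + 1 : ℕ) : ℝ) / n))) ρ)
    (hρ : 0 ≤ ρ) (hσ0 : 0 ≤ σbar) (hσ : ∀ c, varD S₀ D c ≤ σbar ^ 2) (hs : 0 < s)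
    (hθ1 : ρ * Real.exp ((5 * s + 2 * (s + 1)) * ΔD / (4 * n)) < 1) :
    ∑ ω : Fin (n + 1) → X,
        (if x ≤ work (fun k : Fin (n + 1) => linAction S₀ D ((k : ℝ) / n)) ω
              - (linFreeEnergy S₀ D 1 - linFreeEnergy S₀ D 0)
          then pathLaw (gibbsLaw (linAction S₀ D (((0 : ℕ) : ℝ) / n))) (fun k : Fin n => P k) ω
          else 0)
      ≤ Real.exp (-(s * x)
          + (s * (s + 1) / 2
              + s * (s + 1) * ((ρ * Real.exp ((5 * s + 2 * (s + 1)) * ΔD / (4 * n)))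
                  / (1 - ρ * Real.exp ((5 * s + 2 * (s + 1)) * ΔD / (4 * n)))))
            * (σbar ^ 2 / n)) := by
  have hPω : ∀ ω : Fin (n + 1) → X,
      0 ≤ pathLaw (gibbsLaw (linAction S₀ D (((0 : ℕ) : ℝ) / n))) (fun k : Fin n => P k) ω :=
    fun ω => (pathLaw_pos (gibbsLaw_pos _) (fun k x y => hPpos k x y) ω).le
  have hmk := sum_ite_le_exp_mul_sum hPω
    (fun ω => work (fun k : Fin (n + 1) => linAction S₀ D ((k : ℝ) / n)) ω
      - (linFreeEnergy S₀ D 1 - linFreeEnergy S₀ D 0)) x hs.le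
  have habs : |(-s)| = s := by rw [abs_neg, abs_of_pos hs]
  have habs1 : |(-s) - 1| = s + 1 := by
    rw [show (-s) - 1 = -(s + 1) by ring, abs_neg, abs_of_pos (by linarith)]
  have hθ1' : ρ * Real.exp ((5 * |(-s)| + 2 * |(-s) - 1|) * ΔD / (4 * n)) < 1 := by
    rwa [habs, habs1]
  have hmgf := expMoment_work_uniform_le (-s) S₀ D P hn hD hPpos hProw hK hρ hσ0 hσ hθ1'
  rw [habs, habs1] at hmgf
  have hts : (-s) * ((-s) - 1) = s * (s + 1) := by ring
  rw [hts, abs_of_pos (by positivity : 0 < s * (s + 1)),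
    max_eq_left (by positivity : (0:ℝ) ≤ s * (s + 1))] at hmgf
  have hmgf' : ∑ ω : Fin (n + 1) → X,
      pathLaw (gibbsLaw (linAction S₀ D (((0 : ℕ) : ℝ) / n))) (fun k : Fin n => P k) ω
        * Real.exp (s * (work (fun k : Fin (n + 1) => linAction S₀ D ((k : ℝ) / n)) ω
            - (linFreeEnergy S₀ D 1 - linFreeEnergy S₀ D 0)))
      ≤ Real.exp ((s * (s + 1) / 2
          + s * (s + 1) * ((ρ * Real.exp ((5 * s + 2 * (s + 1)) * ΔD / (4 * n)))
              / (1 - ρ * Real.exp ((5 * s + 2 * (s + 1)) * ΔD / (4 * n)))))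
          * (σbar ^ 2 / n)) := by
    refine le_of_eq_of_le (sum_congr rfl fun ω _ => ?_) hmgf
    congr 2; ring
  refine hmk.trans ?_
  rw [Real.exp_add]
  exact mul_le_mul_of_nonneg_left hmgf' (Real.exp_pos _).le

/-- **LOWER TAIL OF THE WORK** (second-law "violations").  For `t > 0` with `θ_t < 1`:
`P_F(W − ΔF ≤ −x) ≤ exp(−t·x + (½[t(t−1)]₊ + |t(t−1)|·θ_t/(1−θ_t))·σ̄²/n)`; at `t = 1` this is
the classical `e^{−x}`. -/
theorem lowerTail_work_le (S₀ D : X → ℝ) (P : ℕ → X → X → ℝ) {n : ℕ} (hn : n ≠ 0)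
    {ΔD ρ σbar t x : ℝ} (hD : ∀ x y, |D x - D y| ≤ ΔD) (hPpos : ∀ k x y, 0 < P k x y)
    (hProw : ∀ k x, ∑ y, P k x y = 1)
    (hK : ∀ k, ChiSqContracts (P k) (gibbsLaw (linAction S₀ D (((k + 1 : ℕ) : ℝ) / n))) ρ)
    (hρ : 0 ≤ ρ) (hσ0 : 0 ≤ σbar) (hσ : ∀ c, varD S₀ D c ≤ σbar ^ 2) (ht : 0 < t)
    (hθ1 : ρ * Real.exp ((5 * |t| + 2 * |t - 1|) * ΔD / (4 * n)) < 1) :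
    ∑ ω : Fin (n + 1) → X,
        (if x ≤ -(work (fun k : Fin (n + 1) => linAction S₀ D ((k : ℝ) / n)) ω
              - (linFreeEnergy S₀ D 1 - linFreeEnergy S₀ D 0))
          then pathLaw (gibbsLaw (linAction S₀ D (((0 : ℕ) : ℝ) / n))) (fun k : Fin n => P k) ω
          else 0)
      ≤ Real.exp (-(t * x)
          + (max (t * (t - 1)) 0 / 2
              + |t * (t - 1)| * ((ρ * Real.exp ((5 * |t| + 2 * |t - 1|) * ΔD / (4 * n)))
                  / (1 - ρ * Real.exp ((5 * |t| + 2 * |t - 1|) * ΔD / (4 * n)))))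
            * (σbar ^ 2 / n)) := by
  have hPω : ∀ ω : Fin (n + 1) → X,
      0 ≤ pathLaw (gibbsLaw (linAction S₀ D (((0 : ℕ) : ℝ) / n))) (fun k : Fin n => P k) ω :=
    fun ω => (pathLaw_pos (gibbsLaw_pos _) (fun k x y => hPpos k x y) ω).le
  have hmk := sum_ite_le_exp_mul_sum hPω
    (fun ω => -(work (fun k : Fin (n + 1) => linAction S₀ D ((k : ℝ) / n)) ω
      - (linFreeEnergy S₀ D 1 - linFreeEnergy S₀ D 0))) x ht.le
  have hmgf := expMoment_work_uniform_le t S₀ D P hn hD hPpos hProw hK hρ hσ0 hσ hθ1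
  have hmgf' : ∑ ω : Fin (n + 1) → X,
      pathLaw (gibbsLaw (linAction S₀ D (((0 : ℕ) : ℝ) / n))) (fun k : Fin n => P k) ω
        * Real.exp (t * -(work (fun k : Fin (n + 1) => linAction S₀ D ((k : ℝ) / n)) ω
            - (linFreeEnergy S₀ D 1 - linFreeEnergy S₀ D 0)))
      ≤ Real.exp ((max (t * (t - 1)) 0 / 2
          + |t * (t - 1)| * ((ρ * Real.exp ((5 * |t| + 2 * |t - 1|) * ΔD / (4 * n)))
              / (1 - ρ * Real.exp ((5 * |t| + 2 * |t - 1|) * ΔD / (4 * n)))))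
          * (σbar ^ 2 / n)) := by
    refine le_of_eq_of_le (sum_congr rfl fun ω _ => ?_) hmgf
    congr 2; ring
  refine hmk.trans ?_
  rw [Real.exp_add]
  exact mul_le_mul_of_nonneg_left hmgf' (Real.exp_pos _).le

/-- **Reversible irreducible positive layers**: the MGF envelope with `ρ = max_k λ⋆(P_k)`. -/
theorem expMoment_work_uniform_le_of_reversible [DecidableEq X] (t : ℝ) (S₀ D : X → ℝ)
    (P : ℕ → X → X → ℝ) {n : ℕ} (hn : n ≠ 0) {ΔD ρ σbar : ℝ} (hD : ∀ x y, |D x - D y| ≤ ΔD)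
    (hP : ∀ k, IsRowStochastic (P k)) (hPpos : ∀ k x y, 0 < P k x y)
    (hDB : ∀ k, DetailedBalance (gibbsLaw (linAction S₀ D (((k + 1 : ℕ) : ℝ) / n))) (P k))
    (hirr : ∀ k, IsIrreducible (P k)) (hlam : ∀ k, lambdaStar (P k) ≤ ρ)
    (hσ0 : 0 ≤ σbar) (hσ : ∀ c, varD S₀ D c ≤ σbar ^ 2)
    (hθ1 : ρ * Real.exp ((5 * |t| + 2 * |t - 1|) * ΔD / (4 * n)) < 1) :
    ∑ ω : Fin (n + 1) → X,
        pathLaw (gibbsLaw (linAction S₀ D (((0 : ℕ) : ℝ) / n))) (fun k : Fin n => P k) ω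
          * Real.exp (-(t * (work (fun k : Fin (n + 1) => linAction S₀ D ((k : ℝ) / n)) ω
              - (linFreeEnergy S₀ D 1 - linFreeEnergy S₀ D 0))))
      ≤ Real.exp ((max (t * (t - 1)) 0 / 2
          + |t * (t - 1)| * ((ρ * Real.exp ((5 * |t| + 2 * |t - 1|) * ΔD / (4 * n)))
              / (1 - ρ * Real.exp ((5 * |t| + 2 * |t - 1|) * ΔD / (4 * n)))))
          * (σbar ^ 2 / n)) := by
  have hρ : 0 ≤ ρ := (lambdaStar_nonneg (P 0)).trans (hlam 0)
  refine expMoment_work_uniform_le t S₀ D P hn hD hPpos (fun k => (hP k).2) (fun k => ?_)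
    hρ hσ0 hσ hθ1
  exact (chiSqContracts_of_reversible (gibbsLaw_pos _) (sum_gibbsLaw _) (hP k) (hDB k)
    (hirr k)).mono (fun x => (gibbsLaw_pos _ x).le) (lambdaStar_nonneg _) (hlam k)

end Summit.Ventures.LatticeQCDFlow.Scaling
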